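import Mathlib
import Summits.Ventures.PercRepro2.SwOutReducible
import Summits.Ventures.PercRepro2.SwAllFreeBits
import Summits.Ventures.PercRepro2.SwAllLeafMarkDefs

/-!
# A graph-level row is a base of the reduction at every parked region
(blind cell PercRepro2, night-4 g31, 2026-08-28; proofs/NIGHT4-G31.md)

The reduction `Reducible` (night-4 g10) shrinks the region `U` by parking vertices: after a
series, leaf or loop step the removed vertex carries only loops.  Its base case asks for the
rigid inequality on EVERY class of the region (`∀ ξ, RigidOK ends l h o U ξ`).  A theorem of the
lane stated at the level of the GRAPH (`SwAll ends l h o`: the leaf-mark step of g27, the H-, L-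
and LH-mark steps of g30, the general mark step of this seat) is such a base as soon as every
vertex outside `U` other than `l` carries only loops (**`rigidOK_of_swAll_of_parked`**,
**`reducible_of_swAll_of_parked`**): the edges not touching `U` are then loops at `l` and at the
parked vertices, which no cluster sees (`openGraph_eq_of_agree_off_loops`), the hull of `h` is
inside `U` on the side of the mark (`notMem_cluster_of_loops_only`), and the counting inequality
of the row (`card_le_of_swAll`) restricts to every colouring of those loops by the FREE-BITS lemma
(`card_filter_le_of_free_bits`).  This is the form in which the census model of the lane applies
the graph-level steps at every node of the reduction (mining/night-4/g31/README.md).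
-/

namespace Summit.Ventures.PercRepro2

namespace LocRows

open Hull

variable {V : Type*} {E : Type*} [Fintype E] [DecidableEq E]

open scoped Classical

section Loops

variable {ends : E → Sym2 V}

omit [Fintype E] [DecidableEq E] in
/-- A vertex carrying only loops is in no cluster of another vertex. -/
lemma notMem_cluster_of_loops_only {ω : Config E} {y v : V}
    (hy : ∀ e, y ∈ ends e → ends e = s(y, y)) (hv : v ≠ y) : y ∉ cluster ends ω v := by
  intro hyv
  have key : y ∈ {w | w ≠ y} := by
    refine mem_of_conn_of_closed (ends := ends) (ω := ω) ?_ hv hyv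
    intro a ha b hab hby
    obtain ⟨hne, e, _, hends⟩ := openGraph_adj.1 hab
    rw [hby] at hne hends
    have : ends e = s(y, y) := hy e (by rw [hends]; exact Sym2.mem_mk_right _ _)
    rw [this, Sym2.eq_iff] at hends
    rcases hends with ⟨h1, -⟩ | ⟨-, h1⟩ <;> exact hne h1.symm
  exact key rfl

omit [Fintype E] [DecidableEq E] in
/-- Two configurations agreeing off a set of loops have the same open graph. -/
lemma openGraph_eq_of_agree_off_loops {D : Set E} (hD : ∀ e ∈ D, ∃ y, ends e = s(y, y))
    {ζ ζ' : Config E} (hag : ∀ e, e ∉ D → ζ' e = ζ e) :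
    openGraph ends ζ' = openGraph ends ζ := by
  ext a b
  rw [openGraph_adj, openGraph_adj]
  have hnot : ∀ e, ends e = s(a, b) → a ≠ b → e ∉ D := by
    intro e he hab heD
    obtain ⟨y, hy⟩ := hD e heD
    rw [hy, Sym2.eq_iff] at he
    rcases he with ⟨h1, h2⟩ | ⟨h1, h2⟩
    · exact hab (h1.symm.trans h2)
    · exact hab (h2.symm.trans h1)
  constructor
  · rintro ⟨hne, e, he, hends⟩
    exact ⟨hne, e, by rw [← hag e (hnot e hends hne)]; exact he, hends⟩
  · rintro ⟨hne, e, he, hends⟩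
    exact ⟨hne, e, by rw [hag e (hnot e hends hne)]; exact he, hends⟩

omit [Fintype E] [DecidableEq E] in
/-- Two configurations agreeing off a set of loops have the same clusters. -/
lemma cluster_eq_of_agree_off_loops {D : Set E} (hD : ∀ e ∈ D, ∃ y, ends e = s(y, y))
    {ζ ζ' : Config E} (hag : ∀ e, e ∉ D → ζ' e = ζ e) (v : V) :
    cluster ends ζ' v = cluster ends ζ v := by
  ext w
  simp only [mem_cluster, Conn, openGraph_eq_of_agree_off_loops hD hag]

omit [Fintype E] [DecidableEq E] in
/-- Two configurations agreeing off a set of loops at vertices outside the cluster of `h` of one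
of them have the same red edge set of `h`. -/
lemma redEdges_eq_of_agree_off_loops {D : Set E} {h : V} {ζ ζ' : Config E}
    (hD : ∀ e ∈ D, ∃ y, ends e = s(y, y) ∧ y ∉ cluster ends ζ h)
    (hag : ∀ e, e ∉ D → ζ' e = ζ e) :
    redEdges ends ζ' h = redEdges ends ζ h := by
  have hD' : ∀ e ∈ D, ∃ y, ends e = s(y, y) := fun e he => (hD e he).imp fun _ h' => h'.1
  ext e
  simp only [mem_redEdges, cluster_eq_of_agree_off_loops hD' hag]
  by_cases heD : e ∈ D
  · obtain ⟨y, hy, hyc⟩ := hD e heD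
    have hnot : e ∉ within ends (cluster ends ζ h) := by
      rintro ⟨a, ha, b, hb, hab⟩
      rw [hy, Sym2.eq_iff] at hab
      rcases hab with ⟨h1, -⟩ | ⟨h1, -⟩
      · exact hyc (by rw [h1]; exact ha)
      · exact hyc (by rw [h1]; exact hb)
    simp only [hnot, and_false]
  · rw [hag e heD]

omit [Fintype E] [DecidableEq E] in
/-- Every element of `Sym2 V` is a pair. -/
lemma exists_eq_mk (z : Sym2 V) : ∃ a b : V, z = s(a, b) := by
  induction z using Sym2.ind with
  | h a b => exact ⟨a, b, rfl⟩

end Loops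

section Parked

variable {ends : E → Sym2 V} {l h o : V} {U : Set V}

/-- **A graph-level row is a base of the reduction at every parked region**: with `h ∈ U`,
`l ∉ U` and every vertex outside `U` other than `l` carrying only loops, row 2′SW-ALL gives the
rigid inequality on every class of `U`. -/
theorem rigidOK_of_swAll_of_parked (hhU : h ∈ U) (hlU : l ∉ U)
    (hpark : ∀ y, y ∉ U → y ≠ l → ∀ e, y ∈ ends e → ends e = s(y, y))
    (hs : SwAll ends l h o) (ξ : Config E) : RigidOK ends l h o U ξ := by
  intro 𝓔 h𝓔
  have hhl : h ≠ l := fun h' => hlU (h' ▸ hhU)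
  set Q := tgtU ends l h {S : Set V | o ∈ S} with hQ
  set D : Set E := {e | e ∉ touches ends U} with hD
  -- the edges not touching `U` are loops at `l` or at parked vertices
  have hloops : ∀ e ∈ D, ∃ y, ends e = s(y, y) ∧ y ∉ U := by
    intro e he
    obtain ⟨a, b, hab⟩ := exists_eq_mk (ends e)
    have haU : a ∉ U := fun h' => he ⟨a, h', b, hab⟩
    have hbU : b ∉ U := fun h' => he ⟨b, h', a, by rw [hab, Sym2.eq_swap]⟩
    by_cases hal : a = l
    · by_cases hbl : b = l
      · exact ⟨l, by rw [hab, hal, hbl], hlU⟩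
      · exact ⟨b, hpark b hbU hbl e (by rw [hab]; exact Sym2.mem_mk_right _ _), hbU⟩
    · exact ⟨a, hpark a haU hal e (by rw [hab]; exact Sym2.mem_mk_left _ _), haU⟩
  have hloops' : ∀ e ∈ D, ∃ y, ends e = s(y, y) := fun e he => (hloops e he).imp fun _ h' => h'.1
  -- a vertex outside `U` is in no cluster of `h` of a configuration of `Q`
  have hnoth : ∀ ζ ∈ Q, ∀ y, y ∉ U → y ∉ cluster ends ζ h ∧ y ∉ cluster ends (blue ζ) h := by
    intro ζ hζ y hyU
    by_cases hyl : y = l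
    · subst hyl
      have := l_notMem_hull_of_mem_tgtU hζ
      exact ⟨fun h' => this (Or.inl h'), fun h' => this (Or.inr h')⟩
    · have hhy : h ≠ y := fun h' => hyU (h' ▸ hhU)
      exact ⟨notMem_cluster_of_loops_only (hpark y hyU hyl) hhy,
        notMem_cluster_of_loops_only (hpark y hyU hyl) hhy⟩
  -- `Q` is saturated on `D`
  have hS : ∀ ζ ∈ Q, ∀ ζ', (∀ e, e ∉ D → ζ' e = ζ e) → ζ' ∈ Q := by
    intro ζ hζ ζ' hag
    have hagb : ∀ e, e ∉ D → blue ζ' e = blue ζ e := fun e he => by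
      rw [blue_apply, blue_apply, hag e he]
    rw [hQ, LocRows.mem_tgt_iff] at hζ ⊢
    simp only [hull] at hζ ⊢
    rw [cluster_eq_of_agree_off_loops hloops' hag, cluster_eq_of_agree_off_loops hloops' hagb]
    exact hζ
  -- the predicates, kept opaque
  obtain ⟨PR, hPR_def⟩ : ∃ PR : Config E → Prop, ∀ ζ, PR ζ ↔ ζ ∈ Q ∧ redEdges ends ζ h ∈ 𝓔 :=
    ⟨_, fun _ => Iff.rfl⟩
  obtain ⟨PB, hPB_def⟩ : ∃ PB : Config E → Prop, ∀ ζ, PB ζ ↔ ζ ∈ Q ∧ blueEdges ends ζ h ∈ 𝓔 :=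
    ⟨_, fun _ => Iff.rfl⟩
  obtain ⟨Pat, hPat_def⟩ : ∃ Pat : Config E → Prop, ∀ ζ, Pat ζ ↔ ∀ e, e ∈ D → ζ e = ξ e :=
    ⟨_, fun _ => Iff.rfl⟩
  have hPR : ∀ ζ ζ', (∀ e, e ∉ D → ζ' e = ζ e) → PR ζ → PR ζ' := by
    intro ζ ζ' hag hζ
    rw [hPR_def] at hζ ⊢
    refine ⟨hS ζ hζ.1 ζ' hag, ?_⟩
    rw [redEdges_eq_of_agree_off_loops (fun e he => ?_) hag]
    · exact hζ.2
    · obtain ⟨y, hy, hyU⟩ := hloops e he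
      exact ⟨y, hy, (hnoth ζ hζ.1 y hyU).1⟩
  have hPB : ∀ ζ ζ', (∀ e, e ∉ D → ζ' e = ζ e) → PB ζ → PB ζ' := by
    intro ζ ζ' hag hζ
    rw [hPB_def] at hζ ⊢
    refine ⟨hS ζ hζ.1 ζ' hag, ?_⟩
    have hagb : ∀ e, e ∉ D → blue ζ' e = blue ζ e := fun e he => by
      rw [blue_apply, blue_apply, hag e he]
    show redEdges ends (blue ζ') h ∈ 𝓔
    rw [redEdges_eq_of_agree_off_loops (fun e he => ?_) hagb]
    · exact hζ.2
    · obtain ⟨y, hy, hyU⟩ := hloops e he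
      exact ⟨y, hy, (hnoth ζ hζ.1 y hyU).2⟩
  have hPat : ∀ ζ ζ', (∀ e, e ∈ D → ζ' e = ζ e) → Pat ζ → Pat ζ' := by
    intro ζ ζ' hag hζ
    rw [hPat_def] at hζ ⊢
    intro e he
    rw [hag e he, hζ e he]
  -- the class is `Q` on the pattern
  have hclass : ∀ ζ, ζ ∈ swOutSide ends l h o U ξ ↔ ζ ∈ Q ∧ Pat ζ := by
    intro ζ
    rw [mem_swOutSide, mem_outClass, hPat_def]
    constructor
    · rintro ⟨hζ, hag, -⟩
      exact ⟨hζ, fun e he => hag e he⟩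
    · rintro ⟨hζ, hag⟩
      refine ⟨hζ, fun e he => hag e he, ?_⟩
      intro w hw
      by_contra hwU
      rcases hw with hw | hw
      · exact (hnoth ζ hζ w hwU).1 hw
      · exact (hnoth ζ hζ w hwU).2 hw
  have eR : (swOutSide ends l h o U ξ).filter (fun ζ => redEdges ends ζ h ∈ 𝓔) =
      (Q.filter PR).filter Pat := by
    ext ζ
    simp only [Finset.mem_filter, hclass, hPR_def]
    tauto
  have eB : (swOutSide ends l h o U ξ).filter (fun ζ => blueEdges ends ζ h ∈ 𝓔) =
      (Q.filter PB).filter Pat := by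
    ext ζ
    simp only [Finset.mem_filter, hclass, hPB_def]
    tauto
  have hle : (Q.filter PR).card ≤ (Q.filter PB).card := by
    have e1 : Q.filter PR = Q.filter fun ζ => redEdges ends ζ h ∈ 𝓔 := by
      ext ζ; simp only [Finset.mem_filter, hPR_def]; tauto
    have e2 : Q.filter PB = Q.filter fun ζ => blueEdges ends ζ h ∈ 𝓔 := by
      ext ζ; simp only [Finset.mem_filter, hPB_def]; tauto
    rw [e1, e2]
    exact card_le_of_swAll hs 𝓔 h𝓔
  rw [eR, eB]
  exact card_filter_le_of_free_bits (D := D) Q hS PR PB hPR hPB Pat hPat hle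

/-- **A graph-level row makes a parked region a base of the reduction.** -/
theorem reducible_of_swAll_of_parked (hhU : h ∈ U) (hlU : l ∉ U)
    (hpark : ∀ y, y ∉ U → y ≠ l → ∀ e, y ∈ ends e → ends e = s(y, y))
    (hs : SwAll ends l h o) : Reducible l h o ends U :=
  Reducible.base ends U fun ξ => rigidOK_of_swAll_of_parked hhU hlU hpark hs ξ

end Parked

end LocRows

end Summit.Ventures.PercRepro2
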